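import Summits.CriticalPhenomena.PercolationContinuityZ3.Theorems.PercNearOneGluingNoHeavyRsw3SlabPlateRenormalizationGeneral
import HarnessLib

/-!
# RSW3 lane (P2, gen 12): PLATE GLUING with SPREAD cells — the gluing step and the footprint geometry for plates
# `{0..n+s₀} × {0..n} × {0..B}` and zones `{0..n} × {0..s₁+n} × {0..B}` (dependence range independent of `s₁`)

builds on p205010 (kernel theorem, internal audit signed; external expert review pending)

Cell `prim-rsw3`, prover seat `prim-rsw3-p2` (gen 12), memo `run/shared/lean/prim/rsw3/P2-RSWLITE.md` §18.
Support file (`--supports stmt-CriticalPhenomena-4575`); no definitions, no named facts, no sorries.  The parametric form of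
`…Rsw3SlabPlateRenormalization(General)`: cells `b ∈ ℤ²`; plate `Π_b = (s₀ b₀, s₁ b₁, 0) + {0..n+s₀} × {0..n} × {0..B}` crossed along `x₀`;
uniqueness zones `Z_c = (s₀ c₀ + s₀, s₁ c₁, 0) + S`, `S = {0..n} × {0..s₁+n} × {0..B}`, for the FOUR cells `c = b - δ`, `δ ∈ {0,1}²`; a zone covers
the `2 × 2` plates `c + {0,1}²` (each spans it in direction `0` and lies inside it laterally), so `★`-adjacent regular cells `b, b'` glue in the
zone indexed by `(min b₀ b₀', min b₁ b₁')` (`reachable_of_slabUniq_plates_aspect`); the cell spacing `s₁ ≥ n + 1` in `x₁` is the zone width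
minus `n` (cells are spread with the box), so footprints `(s₀ b₀, s₁ b₁ - s₁, 0) + {0..n+s₀} × {0..2s₁+n} × {0..B}` are disjoint at sup-distance
`> r` as soon as `r ≥ 2` and `r s₀ ≥ n + 1` — a range independent of `s₁` and `B`.  This file holds the gluing step
(`reachable_of_slabUniq_plates_aspect`) and the footprint geometry; the criterion itself is `…Rsw3SlabPlateRenormalizationAspect`.

References: M. Aizenman, Nucl. Phys. B 485 (1997) 551–582, §2 Thm. 2 and criterion (ii) [Aizenman1997]; G. Grimmett, *Percolation* (1999),
§1.6, §2.2, §7.4 [GrimmettPercolation1999]. [folklore]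
-/

noncomputable section

namespace Summit.CriticalPhenomena.PercolationContinuityZ3.Theorems.Rsw3

open MeasureTheory Literature.Probability.LatticeModels Literature.Probability.Percolation
open Literature.Probability.Percolation.KestenZhang Literature.Probability.Percolation.KozmaNitzan SimpleGraph Relation
open Summit.CriticalPhenomena.PercolationContinuityZ3.Theorems.Crossing SurfaceTension

/-! ## Plate crossings are spanning crossings of every zone they traverse: the gluing step -/

/-- **Uniqueness in a zone glues the crossings of any two plates traversing it.**  Plates `u + {0..g} × {0..n} × {0..B}` and
`u' + …`, zone `Z = v + {0..n} × {0..A} × {0..B}` (`u 2 = u' 2 = v 2 = 0`) with `u 0 ≤ v 0`, `v 0 + n ≤ u 0 + g`, `v 1 ≤ u 1`, `u 1 + n ≤ v 1 + A` (and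
the same for `u'`): an `x₀`-crossing of either plate contains, between its last visit to `{x₀ ≤ v 0}` and its first visit to `{x₀ ≥ v 0 + n}`, a
spanning crossing of `Z`; if the spanning paths of `Z` are all joined inside `Z`, the two plate crossings are joined.
[cite: Aizenman1997, §2 (proof of Thm. 2: chains of regular cells glue their spanning clusters)] -/
theorem reachable_of_slabUniq_plates_aspect {n g A B : ℕ} {v u u' : Site 3} (hv2 : v 2 = 0) (hu2 : u 2 = 0) (hu'2 : u' 2 = 0)
    (h₁ : u 0 ≤ v 0) (h₂ : v 0 + (n : ℤ) ≤ u 0 + (g : ℤ)) (h₃ : v 1 ≤ u 1) (h₄ : u 1 + (n : ℤ) ≤ v 1 + (A : ℤ))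
    (h₁' : u' 0 ≤ v 0) (h₂' : v 0 + (n : ℤ) ≤ u' 0 + (g : ℤ)) (h₃' : v 1 ≤ u' 1) (h₄' : u' 1 + (n : ℤ) ≤ v 1 + (A : ℤ))
    {ω : BondConfig (Site 3)}
    (hU : ω ∈ {ω : BondConfig (Site 3) |
      ∀ x ∈ (Finset.Icc (0 : Site 3) ![(n : ℤ), (A : ℤ), (B : ℤ)]).image (· + v),
      ∀ x' ∈ (Finset.Icc (0 : Site 3) ![(n : ℤ), (A : ℤ), (B : ℤ)]).image (· + v),
      ∀ y ∈ (Finset.Icc (0 : Site 3) ![(n : ℤ), (A : ℤ), (B : ℤ)]).image (· + v),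
      ∀ y' ∈ (Finset.Icc (0 : Site 3) ![(n : ℤ), (A : ℤ), (B : ℤ)]).image (· + v),
        x 0 = v 0 → x' 0 = v 0 → y 0 = v 0 + (n : ℤ) → y' 0 = v 0 + (n : ℤ) →
        ω ∈ inConn ↑((Finset.Icc (0 : Site 3) ![(n : ℤ), (A : ℤ), (B : ℤ)]).image (· + v)) x y →
        ω ∈ inConn ↑((Finset.Icc (0 : Site 3) ![(n : ℤ), (A : ℤ), (B : ℤ)]).image (· + v)) x' y' →
        ω ∈ inConn ↑((Finset.Icc (0 : Site 3) ![(n : ℤ), (A : ℤ), (B : ℤ)]).image (· + v)) x x'})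
    {x y x' y' : Site 3} (hx0 : x 0 = u 0) (hy0 : y 0 = u 0 + (g : ℤ)) (hx'0 : x' 0 = u' 0) (hy'0 : y' 0 = u' 0 + (g : ℤ))
    (hx : x ∈ (Finset.Icc (0 : Site 3) ![(g : ℤ), (n : ℤ), (B : ℤ)]).image (· + u))
    (hx' : x' ∈ (Finset.Icc (0 : Site 3) ![(g : ℤ), (n : ℤ), (B : ℤ)]).image (· + u'))
    (hxy : ω ∈ inConn ↑((Finset.Icc (0 : Site 3) ![(g : ℤ), (n : ℤ), (B : ℤ)]).image (· + u)) x y)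
    (hx'y' : ω ∈ inConn ↑((Finset.Icc (0 : Site 3) ![(g : ℤ), (n : ℤ), (B : ℤ)]).image (· + u')) x' y') :
    (openGraph ω).Reachable x x' := by
  classical
  set β : Finset (Site 3) := (Finset.Icc (0 : Site 3) ![(n : ℤ), (A : ℤ), (B : ℤ)]).image (· + v) with hβ
  set ℓ₁ : ℤ := v 0 with hℓ₁
  set ℓ₂ : ℤ := v 0 + (n : ℤ) with hℓ₂
  have hn0 : (0 : ℤ) ≤ n := by positivity
  -- membership in `β` from the coordinates
  have hmemβ : ∀ z : Site 3, ℓ₁ ≤ z 0 → z 0 ≤ ℓ₂ → v 1 ≤ z 1 → z 1 ≤ v 1 + (A : ℤ) →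
      0 ≤ z 2 → z 2 ≤ (B : ℤ) → z ∈ β := by
    intro z h1 h2 h3 h4 h5 h6
    rw [hβ, mem_image_Icc_add_iff]
    intro j
    fin_cases j
    · show v 0 ≤ z 0 ∧ z 0 ≤ (![(n : ℤ), (A : ℤ), (B : ℤ)] : Site 3) 0 + v 0
      simp; constructor <;> omega
    · show v 1 ≤ z 1 ∧ z 1 ≤ (![(n : ℤ), (A : ℤ), (B : ℤ)] : Site 3) 1 + v 1
      simp; constructor <;> omega
    · show v 2 ≤ z 2 ∧ z 2 ≤ (![(n : ℤ), (A : ℤ), (B : ℤ)] : Site 3) 2 + v 2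
      simp; rw [hv2]; constructor <;> omega
  -- a sub-walk of a plate crossing inside `β`
  have hplate : ∀ {t a c : Site 3}, t 2 = 0 → t 0 ≤ v 0 → v 0 + n ≤ t 0 + g → v 1 ≤ t 1 → t 1 + n ≤ v 1 + A →
      a 0 = t 0 → c 0 = t 0 + g →
      a ∈ (Finset.Icc (0 : Site 3) ![(g : ℤ), (n : ℤ), (B : ℤ)]).image (· + t) →
      ω ∈ inConn ↑((Finset.Icc (0 : Site 3) ![(g : ℤ), (n : ℤ), (B : ℤ)]).image (· + t)) a c →
      ∃ q r : Site 3, q ∈ β ∧ r ∈ β ∧ q 0 = ℓ₁ ∧ r 0 = ℓ₂ ∧ (openGraph ω).Reachable a q ∧ ω ∈ inConn ↑β q r := by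
    intro t a c ht2 e1 e2 e3 e4 ha0 hc0 ha hac
    set Pl : Finset (Site 3) := (Finset.Icc (0 : Site 3) ![(g : ℤ), (n : ℤ), (B : ℤ)]).image (· + t) with hPl
    rw [mem_inConn_iff] at hac
    obtain ⟨Wk⟩ := hac
    have hHle : openGraph ω ⊓ withinGraph (zdGraph 3) (↑Pl : Set (Site 3)) ≤ zdGraph 3 :=
      fun a b hab => (withinGraph_adj.1 hab.2).1
    have hHS : openGraph ω ⊓ withinGraph (zdGraph 3) (↑Pl : Set (Site 3)) ≤ withinGraph (zdGraph 3) ↑Pl := inf_le_right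
    obtain ⟨q, r, hq, hr, haq, hqr⟩ := exists_subwalk_between_levels hHle Wk 0 (ℓ₁ := ℓ₁) (ℓ₂ := ℓ₂)
      (by rw [ha0, hℓ₁]; exact e1) (by rw [hℓ₁, hℓ₂]; omega) (by rw [hc0, hℓ₂]; omega)
    -- all vertices involved lie in the plate
    have hmemPl : ∀ {z : Site 3}, z ∈ Pl → (t 0 ≤ z 0 ∧ z 0 ≤ t 0 + g) ∧ (t 1 ≤ z 1 ∧ z 1 ≤ t 1 + n) ∧
        (0 ≤ z 2 ∧ z 2 ≤ (B : ℤ)) := by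
      intro z hz
      rw [hPl, mem_image_Icc_add_iff] at hz
      have a0 := hz 0; have a1 := hz 1; have a2 := hz 2
      simp at a0 a1 a2
      rw [ht2] at a2
      exact ⟨⟨a0.1, by linarith⟩, ⟨a1.1, by linarith⟩, ⟨by linarith, by linarith⟩⟩
    have hqPl : q ∈ Pl := by
      obtain ⟨W₁⟩ := haq
      have := getVert_mem_of_le_withinGraph hHS W₁ (Finset.mem_coe.2 ha) W₁.length
      rwa [W₁.getVert_length, Finset.mem_coe] at this
    have hsub : (↑Pl : Set (Site 3)) ∩ {z : Site 3 | ℓ₁ ≤ z 0 ∧ z 0 ≤ ℓ₂} ⊆ ↑β := by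
      rintro z ⟨hz, hz1, hz2⟩
      rw [Finset.mem_coe] at hz ⊢
      obtain ⟨-, ⟨b1, b2⟩, ⟨c1, c2⟩⟩ := hmemPl hz
      exact hmemβ z hz1 hz2 (by omega) (by omega) c1 c2
    have hle : openGraph ω ⊓ withinGraph (zdGraph 3) (↑Pl : Set (Site 3)) ⊓
          withinGraph (zdGraph 3) {z : Site 3 | ℓ₁ ≤ z 0 ∧ z 0 ≤ ℓ₂} ≤
        openGraph ω ⊓ withinGraph (zdGraph 3) (↑β : Set (Site 3)) := by
      intro a b hab
      obtain ⟨⟨hopen, hPl'⟩, hlev⟩ := hab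
      rw [withinGraph_adj] at hPl' hlev
      refine ⟨hopen, ?_⟩
      rw [withinGraph_adj]
      exact ⟨hPl'.1, hsub ⟨hPl'.2.1, hlev.2.1⟩, hsub ⟨hPl'.2.2, hlev.2.2⟩⟩
    have hqβ : q ∈ β := by
      have := (hmemPl hqPl)
      exact hmemβ q (by rw [hq]) (by rw [hq, hℓ₁, hℓ₂]; omega) (by omega) (by omega) this.2.2.1 this.2.2.2
    have hrβ : r ∈ β := by
      rcases eq_or_ne q r with h | h
      · rw [← h]; exact hqβ
      · obtain ⟨W₂⟩ := hqr.mono hle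
        cases W₂ with
        | nil => exact absurd rfl h
        | cons hadj W₃ =>
          have := getVert_mem_of_le_withinGraph (inf_le_right : openGraph ω ⊓ withinGraph (zdGraph 3) (↑β : Set (Site 3)) ≤ _)
            W₃ (withinGraph_adj.1 hadj.2).2.2 W₃.length
          rwa [W₃.getVert_length, Finset.mem_coe] at this
    refine ⟨q, r, hqβ, hrβ, hq, hr, haq.mono inf_le_left, ?_⟩
    rw [mem_inConn_iff]
    exact hqr.mono hle
  -- the two sub-walks
  obtain ⟨q, r, hqβ, hrβ, hq, hr, hxq, hqr⟩ := hplate hu2 h₁ h₂ h₃ h₄ hx0 hy0 hx hxy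
  obtain ⟨q', r', hq'β, hr'β, hq', hr', hx'q', hq'r'⟩ := hplate hu'2 h₁' h₂' h₃' h₄' hx'0 hy'0 hx' hx'y'
  -- uniqueness inside `β` joins `q` to `q'`
  have hqq' := hU q hqβ q' hq'β r hrβ r' hr'β hq hq' hr hr' hqr hq'r'
  rw [mem_inConn_iff] at hqq'
  exact (hxq.trans (hqq'.mono inf_le_left)).trans hx'q'.symm

/-! ## Footprints of spread cells -/

/-- **Footprints of cells at sup-distance `> r` are disjoint** (`r ≥ 2`, `r s₀ ≥ n + 1`, `s₁ ≥ n + 1`): the boxes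
`(s₀ b₀, s₁ b₁ - s₁, 0) + {0..n+s₀} × {0..2s₁+n} × {0..B}`.  The range `r` depends on `n / s₀` only — not on `s₁` or `B`. [folklore] -/
theorem disjoint_plateFootprint_of_lt_supDist_aspect {n s₀ s₁ B r : ℕ} (hr : 2 ≤ r) (hrs : n + 1 ≤ r * s₀) (hs₁ : n + 1 ≤ s₁)
    {b b' : Site 2} (h : r < supDist b b') :
    Disjoint ((Finset.Icc (0 : Site 3) ![((n + s₀ : ℕ) : ℤ), 2 * (s₁ : ℤ) + (n : ℤ), (B : ℤ)]).image
        (· + ![(s₀ : ℤ) * b 0, (s₁ : ℤ) * b 1 - (s₁ : ℤ), 0]))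
      ((Finset.Icc (0 : Site 3) ![((n + s₀ : ℕ) : ℤ), 2 * (s₁ : ℤ) + (n : ℤ), (B : ℤ)]).image
        (· + ![(s₀ : ℤ) * b' 0, (s₁ : ℤ) * b' 1 - (s₁ : ℤ), 0])) := by
  rw [Finset.disjoint_left]
  intro x hx hx'
  rw [mem_image_Icc_add_iff] at hx hx'
  have hs₀0 : (0 : ℤ) ≤ s₀ := by positivity
  have hs₁0 : (0 : ℤ) ≤ s₁ := by positivity
  have hrs' : (n : ℤ) + 1 ≤ (r : ℤ) * (s₀ : ℤ) := by exact_mod_cast hrs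
  have hs₁' : (n : ℤ) + 1 ≤ (s₁ : ℤ) := by exact_mod_cast hs₁
  have hx0 := hx 0; have hx'0 := hx' 0; have hx1 := hx 1; have hx'1 := hx' 1
  simp at hx0 hx'0 hx1 hx'1
  have key0 : ∀ {c c' : ℤ}, (s₀ : ℤ) * c ≤ (n : ℤ) + (s₀ : ℤ) + (s₀ : ℤ) * c' → c ≤ c' + r := by
    intro c c' h1
    by_contra hc
    push Not at hc
    have h3 : c' + (r : ℤ) + 1 ≤ c := by omega
    have h4 : (s₀ : ℤ) * (c' + (r : ℤ) + 1) ≤ (s₀ : ℤ) * c := mul_le_mul_of_nonneg_left h3 hs₀0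
    nlinarith
  have key1 : ∀ {c c' : ℤ}, (s₁ : ℤ) * c - (s₁ : ℤ) ≤ 2 * (s₁ : ℤ) + (n : ℤ) + ((s₁ : ℤ) * c' - (s₁ : ℤ)) → c ≤ c' + 2 := by
    intro c c' h1
    by_contra hc
    push Not at hc
    have h3 : c' + 3 ≤ c := by omega
    have h4 : (s₁ : ℤ) * (c' + 3) ≤ (s₁ : ℤ) * c := mul_le_mul_of_nonneg_left h3 hs₁0
    nlinarith
  have a0 : b 0 ≤ b' 0 + r := key0 (by linarith [hx0.1, hx'0.2])
  have a0' : b' 0 ≤ b 0 + r := key0 (by linarith [hx'0.1, hx0.2])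
  have a1 : b 1 ≤ b' 1 + 2 := key1 (by linarith [hx1.1, hx'1.2])
  have a1' : b' 1 ≤ b 1 + 2 := key1 (by linarith [hx'1.1, hx1.2])
  have hle : supDist b b' ≤ r := by
    rw [supDist_le_iff]
    intro i
    fin_cases i
    · show (b 0 - b' 0).natAbs ≤ r; omega
    · show (b 1 - b' 1).natAbs ≤ r; omega
  omega

/-! ## Footprint containments -/

/-- The plate `(s₀ b₀, s₁ b₁, 0) + {0..n+s₀} × {0..n} × {0..B}` lies in the footprint `(s₀ b₀, s₁ b₁ - s₁, 0) + {0..n+s₀} × {0..2s₁+n} × {0..B}`.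
[folklore] -/
theorem plate_subset_footprint (n s₀ s₁ B : ℕ) (b : Site 2) :
    (Finset.Icc (0 : Site 3) ![((n + s₀ : ℕ) : ℤ), (n : ℤ), (B : ℤ)]).image (· + ![(s₀ : ℤ) * b 0, (s₁ : ℤ) * b 1, 0]) ⊆
      (Finset.Icc (0 : Site 3) ![((n + s₀ : ℕ) : ℤ), 2 * (s₁ : ℤ) + (n : ℤ), (B : ℤ)]).image
        (· + ![(s₀ : ℤ) * b 0, (s₁ : ℤ) * b 1 - (s₁ : ℤ), 0]) := by
  intro x hx
  rw [mem_image_Icc_add_iff] at hx ⊢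
  have hs₁ : (0 : ℤ) ≤ s₁ := by positivity
  intro i
  have := hx i
  fin_cases i
  · simpa using this
  · simp at this ⊢; constructor <;> linarith [this.1, this.2]
  · simpa using this

/-- A zone `(ζ₀, ζ₁, 0) + {0..n} × {0..A} × {0..B}` with `s₀ b₀ ≤ ζ₀ ≤ s₀ b₀ + s₀`, `s₁ b₁ - s₁ ≤ ζ₁ ≤ s₁ b₁`, `A = s₁ + n`, lies in the footprint
`(s₀ b₀, s₁ b₁ - s₁, 0) + {0..n+s₀} × {0..2s₁+n} × {0..B}`. [folklore] -/
theorem zone_subset_footprint {n s₀ s₁ A B : ℕ} (hA : (s₁ : ℤ) + (n : ℤ) = (A : ℤ)) (b : Site 2) {ζ₀ ζ₁ : ℤ}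
    (h0 : (s₀ : ℤ) * b 0 ≤ ζ₀) (h0' : ζ₀ ≤ (s₀ : ℤ) * b 0 + (s₀ : ℤ)) (h1 : (s₁ : ℤ) * b 1 - (s₁ : ℤ) ≤ ζ₁)
    (h1' : ζ₁ ≤ (s₁ : ℤ) * b 1) :
    (Finset.Icc (0 : Site 3) ![(n : ℤ), (A : ℤ), (B : ℤ)]).image (· + ![ζ₀, ζ₁, 0]) ⊆
      (Finset.Icc (0 : Site 3) ![((n + s₀ : ℕ) : ℤ), 2 * (s₁ : ℤ) + (n : ℤ), (B : ℤ)]).image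
        (· + ![(s₀ : ℤ) * b 0, (s₁ : ℤ) * b 1 - (s₁ : ℤ), 0]) := by
  intro x hx
  rw [mem_image_Icc_add_iff] at hx ⊢
  intro i
  have := hx i
  fin_cases i
  · simp at this ⊢; constructor <;> linarith [this.1, this.2]
  · simp at this ⊢; constructor <;> linarith [this.1, this.2]
  · simpa using this

end Summit.CriticalPhenomena.PercolationContinuityZ3.Theorems.Rsw3

end
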